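import Summits.Ventures.PercRepro.RankLevelSetLevelTwelveGXTForm
import Summits.Ventures.PercRepro.RankLevelSetCoreTwelveOfFormGXT
import Summits.Ventures.PercRepro.RankLevelSetCoreTwelveLargeCorankGXT
import Summits.Ventures.PercRepro.RankLevelSetLevelElevenGXT
import Summits.Ventures.PercRepro.S3SixWindow

/-!
# PercRepro — THEOREM C₁₂ ON THE GIANT-EXACT COUNT WITH LEMMA T5: C-025 AT LEVEL `12` FOR EVERY FINITE MATROID AND EVERY
`p ≥ 1880` (p2, gen 36; a feeder for S4 — the top of the `q = 12` window, from `2,768`)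

The level-`12` instance of the GXT chains of RankLevelSetLevelElevenGXT: p8 g18's giant-exact count
(`S2.ncard_eRk_eq_ncard_le_le_giant_exact`) with the quartic multiplicity on the non-giant rank-`11` sets and the powerset of the
giant flat, p8's LEMMA T5 (`s₅ ≤ 7·d(d+1)(d+2)(d+3)/48`), the flat bounds `f(12) ≤ 2559`, `f(11) ≤ 1279`
(RankLevelSetLevelTwelveInfraGXT), the mid weight in CLOSED FORM (RankLevelSetLevelElevenSigmaBarGXT) and the TRUNCATED `Y`-tails
(the spanning tail never expanded): every cell `(p, d)`, `13 ≤ d ≤ 2681`, closes at the UNIFORM base `p ≥ 1880` (the 2,669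
polynomial certificates of RankLevelSetLevelTwelveGXTArith{AA…}, the tail bases of RankLevelSetLevelTwelveGXTTails{AA…},
the dispatcher `gxt_form_twelve`), and the large-corank regime closes from corank `2682` (`largeTwelve_all_gxt`); the rows
`≤ 1876` fail at the giant-powerset band `d ≈ 2522 … 2547` on the `N`-side (kit j331050).
* **`c025_core_twelve_bounded_corank_gxt`** — the `e`-free core at level `12`, corank `13 ≤ d ≤ 2681`, rank `p ≥ 1880`;
* **`c025_twelve_of_eleven_gxt_from`** — for every `P ≥ 1880`: level `11` for all `p ≥ P` implies level `12` for all `p ≥ P + 1`;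
* **`c025_twelve_at_eighteen_eighty`** — level `12` at rank `1880`, every finite matroid (the per-rank wrapper
  `rls_succ_large_at 11 12 1880` on level `11` at `1879`, `c025_eleven_large_gxt'`);
* **`c025_twelve_large_gxt'`** — UNCONDITIONAL over the tree: level `12` for every `p ≥ 1880`; **`c025_twelve_large_gxt`** the same
  in the literal `C025` body.
Axioms: standard.
-/

open scoped Matroid

namespace PercRepro

namespace ThmN

open Set

variable {α : Type}

/-- **The `e`-free core at level `12`, corank `13 ≤ d ≤ 2681`, rank `p ≥ 1880`, on the giant-exact count with LEMMA T5**: the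
form of the cell from `gxt_form_twelve` through `c025_core_twelve_of_form_gxt`. -/
theorem c025_core_twelve_bounded_corank_gxt (M : Matroid α) [M.Finite] (p d : ℕ) (hp : 1880 ≤ p) (hd13 : 13 ≤ d)
    (hd2681 : d ≤ 2681) (hR : M.eRank = (p : ℕ∞)) (hn : M.E.ncard = p + d)
    (hfree : ∀ e ∈ M.E, ∃ A ⊆ M.E \ {e}, e ∉ M.closure A ∧ e ∉ M.closure ((M.E \ {e}) \ A)) :
    RLS M p 12 :=
  c025_core_twelve_of_form_gxt M p d hd13 hR hn hfree (gxt_form_twelve d hd13 hd2681 p hp (p + d) (by omega))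

/-- **THEOREM C₁₂ ON THE GIANT-EXACT COUNT WITH LEMMA T5, GIVEN LEVEL `11` FROM `P`**: for every `P ≥ 1880`, level `11` for all
`p ≥ P` implies level `12` for all `p ≥ P + 1` (the core at corank `13 ≤ d ≤ 2681` by `c025_core_twelve_bounded_corank_gxt`, at
corank `≥ 2682` by `c025_core_twelve_large_corank_gxt`; the coranks `≤ 12` are `U = ∅` or Theorem M). -/
theorem c025_twelve_of_eleven_gxt_from (P : ℕ) (hP : 1880 ≤ P)
    (h11 : ∀ (M : Matroid α) [M.Finite] (p : ℕ), P ≤ p → RLS M p 11) :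
    ∀ (M : Matroid α) [M.Finite] (p : ℕ), P + 1 ≤ p → RLS M p 12 := by
  intro M _ p hp
  refine rls_succ_large (α := α) 11 12 P ?_ ?_ ?_ M p hp (by omega)
  · intro M' _ p' hP' _
    exact h11 M' p' hP'
  · intro M' _ p' _ hn _
    rcases Nat.lt_or_ge M'.E.ncard (p' + 12) with h | h
    · exact RLS_of_ncard_lt M' h
    · exact RLS_of_ncard_eq M' (by omega)
  · intro M' _ p' hP' hR hbig _ hfree
    rcases Nat.lt_or_ge M'.E.ncard (p' + 2682) with h | h
    · exact c025_core_twelve_bounded_corank_gxt M' p' (M'.E.ncard - p') (by omega) (by omega) (by omega) hR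
        (by omega) hfree
    · exact c025_core_twelve_large_corank_gxt M' p' (by omega) hR (by omega) hfree

/-- **Level `12` at rank `1880`, every finite matroid**: `rls_succ_large_at 11 12 1880` on level `11` at `1879`
(`c025_eleven_large_gxt'`), the coranks `≤ 12` (`U = ∅` or Theorem M) and the core at `1880`. -/
theorem c025_twelve_at_eighteen_eighty (M : Matroid α) [M.Finite] : RLS M 1880 12 := by
  refine rls_succ_large_at (α := α) 11 12 1880 (by norm_num)
    (fun M _ => c025_eleven_large_gxt' M 1879 (by norm_num)) ?_ ?_ M
  · -- corank `≤ 12`: `U = ∅` or Theorem M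
    intro M _ hn
    rcases Nat.lt_or_ge M.E.ncard (1880 + 12) with h | h
    · exact RLS_of_ncard_lt M h
    · exact RLS_of_ncard_eq M (by omega)
  · -- the core at corank `≥ 13`
    intro M _ hR hbig hfree
    rcases Nat.lt_or_ge M.E.ncard (1880 + 2682) with h | h
    · exact c025_core_twelve_bounded_corank_gxt M 1880 (M.E.ncard - 1880) (le_refl _) (by omega) (by omega) hR
        (by omega) hfree
    · exact c025_core_twelve_large_corank_gxt M 1880 (le_refl _) hR (by omega) hfree

/-- **THEOREM C₁₂ AT `1880`, UNCONDITIONAL OVER THE TREE**: every finite matroid satisfies C-025 at level `12` for every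
`p ≥ 1880` — the row `1880` by `c025_twelve_at_eighteen_eighty`, the rows `≥ 1881` through the wrapper at `P = 1880` on level `11`
for `p ≥ 865` (`c025_eleven_large_gxt'`). -/
theorem c025_twelve_large_gxt' (M : Matroid α) [M.Finite] (p : ℕ) (hp : 1880 ≤ p) : RLS M p 12 := by
  rcases Nat.lt_or_ge p 1881 with h | h
  · have h1880 : p = 1880 := by omega
    subst h1880
    exact c025_twelve_at_eighteen_eighty M
  · exact c025_twelve_of_eleven_gxt_from 1880 (by norm_num)
      (fun M' _ p' hp' => c025_eleven_large_gxt' M' p' (by omega)) M p h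

/-- The same in the literal `C025` body: `phiK p 12 · #U(p, 12) ≤ #Y(p, 12)` for every finite matroid and every `p ≥ 1880`. -/
theorem c025_twelve_large_gxt (M : Matroid α) [M.Finite] (p : ℕ) (hp : 1880 ≤ p) :
    phiK p 12 * ({A : Set α | A ⊆ M.E ∧ M.eRk A = (p : ℕ∞) ∧ M.eRk (M.E \ A) = (12 : ℕ∞)}.ncard : ℚ) ≤
      ({A : Set α | A ⊆ M.E ∧ (12 : ℕ∞) < M.eRk A ∧ M.eRk A < (p : ℕ∞)}.ncard : ℚ) :=
  c025_twelve_large_gxt' M p hp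

end ThmN

end PercRepro
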